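import Mathlib.Algebra.Polynomial.Taylor
import Mathlib.Algebra.Polynomial.Div
import Mathlib.Algebra.Ring.GeomSum
import Mathlib.Data.Nat.Choose.Basic
import Mathlib.Data.Nat.Prime.Basic
import Mathlib.Tactic.IntervalCases
import Mathlib.Tactic.LinearCombination
import Mathlib.Tactic.Ring
import HarnessLib

/-!
# BirchSwinnertonDyer — rank-2 `Ш[p^∞]` cell, STRUCTURE track: the polynomial core of the Taylor lemma [M]

HONEST FRAMING (cell `b2b-bsdr2sha`, run/shared/lean/b2b/bsd-rank2-sha/, structure/THEORY-NOTE-C5.md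
supplement 14, (14.1) «TAYLOR LEMMA [M]»): ELEMENTARY congruences modulo `p³` in an arbitrary commutative
ring, about ONE polynomial `φ` whose reduction mod `p` is a polynomial in `X^p` (for the cell: `φ = φ_p`, the
`p`-th division polynomial `Φ_p` of a Weierstrass curve over `ℤ_p`, whose reduction is `φ̃_p ∈ 𝔽_p[x^p]`).
Nothing here concerns BSD, `Ш`, heights, or any census number; no definition, no named fact, no axiom.
The GEOMETRIC input of (14.1) — «for `B ∈ E₁(ℚ_p)`, `x(S+B) = x_S + p·τ(B)·ψ₂(S) + O(p²)` (formal group)» —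
is NOT typed here: it enters as the hypothesis `x' = x + p·a + p²·b` (read `a = τ(B)·ψ₂(S)`).

WHAT (14.1) SAYS AND WHAT IS TYPED. With `u := φ(x)` a unit with `u^{p−1} ≡ 1 (mod p²)` («`FQ(u) = 0`»,
Corollary B of the note) write `u^{p−1} ≡ 1 + p²·F (mod p³)` (`F = FQ₂(u)`), and let `φ' = p·φ₁`
(possible because `φ̃ ∈ 𝔽_p[x^p]`). Then for `x' ≡ x + p·a (mod p²)`:
* `φ(x') ≡ φ(x) + p·a·φ'(x) = u + p²·a·φ₁(x) (mod p³)` — Taylor to second order; the second-order term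
  dies because the second HASSE derivative of `φ` is `≡ 0 (mod p)` too (for ODD `p`: `p ∣ C(pm, 2)`), the
  first-order correction `φ'(x)·p²b` dies because `p ∣ φ'`;  [`cube_dvd_eval_add_sub`]
* hence with `δ ≡ a·φ₁(x)/u (mod p)`: `φ(x') ≡ u·(1 + p²δ) (mod p³)` and
  `φ(x')^{n} ≡ 1 + p²·(F + n·δ) (mod p³)` for every `n` with `u^n ≡ 1 + p²F (mod p³)`;  [`cube_dvd_pow_sub_of_taylor`]
* at `n = p − 1`: `φ(x')^{p−1} ≡ 1 + p²·(F − δ) (mod p³)`, i.e. **`FQ₂(φ(x')) ≡ FQ₂(φ(x)) − δ (mod p)`** with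
  `δ = σ·τ(B)`, `σ = φ₁(x_S)·ψ₂(S)/φ(x_S) = (φ_p'/p)(x_S)·ψ₂(S̃)/φ_p(x_S)` — exactly the displayed formula of (14.1)
  `FQ₂(φ_p(x(S+B))) ≡ FQ₂(u) − σ_E(S̃)·τ(B) (mod p)`.  [`fermatQuotient₂_taylor`]
The hypotheses «`p ∣` every coefficient of `φ'` and of the second Hasse derivative `D²φ`» are DERIVED from
«every coefficient of `φ` in a degree not divisible by `p` is divisible by `p`» (i.e. `φ ≡ A(X^p) (mod p)`) for odd
`p` in `dvd_coeff_derivative_of_frobenius_shape` / `dvd_coeff_hasseDeriv_two_of_frobenius_shape`, and the headline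
statement with exactly these hypotheses is `fermatQuotient₂_taylor_of_frobenius_shape`.

All statements are divisibilities `p^3 ∣ (… − …)` in a commutative ring `R` (`R = ℤ`, `ℤ_p`, `ℤ/p³ℤ`, …), so that a
numeral instance per census row is a `decide`/`norm_num` matter later. References: the cell's THEORY-NOTE-C5.md
supplement 14 (LEAD g8, 2026-08-23); for Hasse derivatives and Taylor expansion Mathlib
`Mathlib/Algebra/Polynomial/HasseDeriv.lean`, `Mathlib/Algebra/Polynomial/Taylor.lean`.
-/

set_option autoImplicit false

-- single-conjunct summit: `Summit.BirchSwinnertonDyer.BirchSwinnertonDyer.…` repeats the name by design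
set_option linter.dupNamespace false

open Polynomial

namespace Summit.BirchSwinnertonDyer.BirchSwinnertonDyer.Rank2Sha.Structure.TaylorFQ

variable {R : Type*} [CommRing R]

/-- Taylor expansion to second order with an explicit cubic remainder: for every polynomial `f` and
`x, h ∈ R` there is `c ∈ R` with `f(x + h) = f(x) + f'(x)·h + (D²f)(x)·h² + c·h³`, `D²` the second Hasse
derivative (`2·D²f = f''`). -/
theorem exists_eval_add_eq_taylor_two (f : R[X]) (x h : R) :
    ∃ c : R, f.eval (x + h) =
      f.eval x + (derivative f).eval x * h + (hasseDeriv 2 f).eval x * h ^ 2 + c * h ^ 3 := by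
  set g : R[X] := taylor x f -
      (C (f.eval x) + C ((derivative f).eval x) * X + C ((hasseDeriv 2 f).eval x) * X ^ 2) with hg
  have hdvd : (X : R[X]) ^ 3 ∣ g := by
    rw [X_pow_dvd_iff]
    intro d hd
    interval_cases d
    · simp [hg, taylor_coeff_zero, coeff_X, coeff_C, coeff_X_pow]
    · simp [hg, taylor_coeff, coeff_C, coeff_X_pow]
    · simp [hg, taylor_coeff, coeff_X_pow]
  obtain ⟨q, hq⟩ := hdvd
  refine ⟨q.eval h, ?_⟩
  have key := congrArg (eval h) hq
  simp only [hg, eval_sub, eval_add, eval_mul, eval_C, eval_X, eval_pow, taylor_eval] at key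
  rw [add_comm x h]
  linear_combination key

/-- **Taylor modulo `p³`.** If every coefficient of `f'` and of the second Hasse derivative `D²f` is divisible
by `p`, then `f(x + p·a + p²·b) ≡ f(x) + p·a·f'(x) (mod p³)`. -/
theorem cube_dvd_eval_add_sub (p : R) (f : R[X]) (hD1 : ∀ i, p ∣ (derivative f).coeff i)
    (hD2 : ∀ i, p ∣ (hasseDeriv 2 f).coeff i) (x a b : R) :
    p ^ 3 ∣ f.eval (x + (p * a + p ^ 2 * b)) - (f.eval x + p * a * (derivative f).eval x) := by
  obtain ⟨g₁, hg₁⟩ := (C_dvd_iff_dvd_coeff p _).mpr hD1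
  obtain ⟨g₂, hg₂⟩ := (C_dvd_iff_dvd_coeff p _).mpr hD2
  obtain ⟨c, hc⟩ := exists_eval_add_eq_taylor_two f x (p * a + p ^ 2 * b)
  have e1 : (derivative f).eval x = p * g₁.eval x := by rw [hg₁, eval_mul, eval_C]
  have e2 : (hasseDeriv 2 f).eval x = p * g₂.eval x := by rw [hg₂, eval_mul, eval_C]
  refine ⟨g₁.eval x * b + g₂.eval x * (a + p * b) ^ 2 + c * (a + p * b) ^ 3, ?_⟩
  rw [hc, e1, e2]
  ring

/-- `(1 + y)^n = 1 + n·y + r·y²` for some `r`. -/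
theorem exists_one_add_pow_eq (y : R) (n : ℕ) : ∃ r : R, (1 + y) ^ n = 1 + n * y + r * y ^ 2 := by
  induction n with
  | zero => exact ⟨0, by simp⟩
  | succ n ih =>
    obtain ⟨r, hr⟩ := ih
    exact ⟨n + r + r * y, by rw [pow_succ, hr]; push_cast; ring⟩

/-- **The Fermat-quotient shift.** If `uⁿ ≡ 1 + p²F (mod p³)` and `u' ≡ u·(1 + p²δ) (mod p³)` then
`u'ⁿ ≡ 1 + p²(F + n·δ) (mod p³)`. (At `n = p − 1`: `FQ₂(u') ≡ FQ₂(u) − δ (mod p)`.) -/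
theorem cube_dvd_pow_sub_of_shift (p u u' F δ : R) (n : ℕ) (hu : p ^ 3 ∣ u ^ n - (1 + p ^ 2 * F))
    (hu' : p ^ 3 ∣ u' - (u + p ^ 2 * u * δ)) :
    p ^ 3 ∣ u' ^ n - (1 + p ^ 2 * (F + n * δ)) := by
  obtain ⟨G, hG⟩ := hu
  obtain ⟨H, hH⟩ := hu'
  obtain ⟨r, hr⟩ := exists_one_add_pow_eq (p ^ 2 * δ) n
  have h1 : p ^ 3 ∣ u' ^ n - (u * (1 + p ^ 2 * δ)) ^ n := by
    have hd : p ^ 3 ∣ u' - u * (1 + p ^ 2 * δ) := ⟨H, by linear_combination hH⟩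
    exact dvd_trans hd (sub_dvd_pow_sub_pow u' (u * (1 + p ^ 2 * δ)) n)
  have h2 : p ^ 3 ∣ (u * (1 + p ^ 2 * δ)) ^ n - (1 + p ^ 2 * (F + n * δ)) := by
    refine ⟨r * p * δ ^ 2 + F * (n * p * δ + r * p ^ 3 * δ ^ 2) +
      G * (1 + n * (p ^ 2 * δ) + r * (p ^ 2 * δ) ^ 2), ?_⟩
    rw [mul_pow]
    linear_combination (1 + p ^ 2 * δ) ^ n * hG + (1 + p ^ 2 * F + p ^ 3 * G) * hr
  have h12 := dvd_add h1 h2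
  rwa [sub_add_sub_cancel] at h12

/-- **Taylor lemma [M], polynomial core** (THEORY-NOTE supplement 14.1). Let every coefficient of `φ'` and
of `D²φ` be divisible by `p`, `φ' = p·φ₁` at the point `x` in the sense `φ'(x) = p·φ₁x`, `u := φ(x)` with
`uⁿ ≡ 1 + p²F (mod p³)`, `x' = x + p·a + p²·b`, and `δ` with `u·δ ≡ a·φ₁x (mod p)` (i.e. `δ = a·φ₁(x)/u` when
`u` is a unit mod `p`). Then `φ(x')ⁿ ≡ 1 + p²·(F + n·δ) (mod p³)`. -/
theorem cube_dvd_pow_sub_of_taylor (p : R) (φ : R[X]) (hD1 : ∀ i, p ∣ (derivative φ).coeff i)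
    (hD2 : ∀ i, p ∣ (hasseDeriv 2 φ).coeff i) (x a b φ₁x F δ : R) (n : ℕ)
    (hφ₁ : (derivative φ).eval x = p * φ₁x) (hu : p ^ 3 ∣ (φ.eval x) ^ n - (1 + p ^ 2 * F))
    (hδ : p ∣ φ.eval x * δ - a * φ₁x) :
    p ^ 3 ∣ (φ.eval (x + (p * a + p ^ 2 * b))) ^ n - (1 + p ^ 2 * (F + n * δ)) := by
  refine cube_dvd_pow_sub_of_shift p (φ.eval x) _ F δ n hu ?_
  obtain ⟨c, hc⟩ := cube_dvd_eval_add_sub p φ hD1 hD2 x a b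
  obtain ⟨d, hd⟩ := hδ
  exact ⟨c - d, by linear_combination hc - p ^ 2 * hd + p * a * hφ₁⟩

/-- **`FQ₂` form at `n = p − 1`** (the displayed formula of (14.1)): with the hypotheses of
`cube_dvd_pow_sub_of_taylor` for a natural number `p ≥ 1` (cast into `R`) and `n = p − 1`,
`φ(x')^{p−1} ≡ 1 + p²·(F − δ) (mod p³)` — i.e. `FQ₂(φ(x')) ≡ FQ₂(φ(x)) − δ (mod p)`, `δ = σ·τ` in the note's
notation (`a = τ(B)ψ₂(S)`, `σ = φ₁(x_S)ψ₂(S)/φ(x_S)`). -/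
theorem fermatQuotient₂_taylor (p : ℕ) (hp : 1 ≤ p) (φ : R[X])
    (hD1 : ∀ i, (p : R) ∣ (derivative φ).coeff i) (hD2 : ∀ i, (p : R) ∣ (hasseDeriv 2 φ).coeff i)
    (x a b φ₁x F δ : R) (hφ₁ : (derivative φ).eval x = p * φ₁x)
    (hu : (p : R) ^ 3 ∣ (φ.eval x) ^ (p - 1) - (1 + (p : R) ^ 2 * F))
    (hδ : (p : R) ∣ φ.eval x * δ - a * φ₁x) :
    (p : R) ^ 3 ∣ (φ.eval (x + (p * a + (p : R) ^ 2 * b))) ^ (p - 1) - (1 + (p : R) ^ 2 * (F - δ)) := by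
  obtain ⟨c, hc⟩ := cube_dvd_pow_sub_of_taylor (p : R) φ hD1 hD2 x a b φ₁x F δ (p - 1) hφ₁ hu hδ
  have hcast : ((p - 1 : ℕ) : R) = (p : R) - 1 := by
    rw [Nat.cast_sub hp, Nat.cast_one]
  rw [hcast] at hc
  exact ⟨c + δ, by linear_combination hc⟩

/-- For ODD `p` and `p ∣ m`: `p ∣ C(m, 2)` (`C(m,2) = m(m−1)/2` and `p` is prime to `2`). -/
theorem dvd_choose_two_of_dvd {p m : ℕ} (hp : Odd p) (hm : p ∣ m) : p ∣ m.choose 2 := by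
  have h2 : 2 * m.choose 2 = m * (m - 1) := by
    rw [Nat.choose_two_right]
    exact Nat.mul_div_cancel' (Nat.even_mul_pred_self m).two_dvd
  have hcop : Nat.Coprime p 2 := (Nat.coprime_two_left.mpr hp).symm
  refine hcop.dvd_of_dvd_mul_left ?_
  rw [h2]
  exact dvd_mul_of_dvd_left hm _

/-- **Frobenius shape ⇒ `p ∣ φ'` coefficientwise.** If every coefficient of `φ` in a degree NOT divisible by
`p` is divisible by `p` (i.e. `φ ≡ A(X^p) (mod p)`), then every coefficient of `φ'` is divisible by `p`. -/
theorem dvd_coeff_derivative_of_frobenius_shape (p : ℕ) (φ : R[X])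
    (hφ : ∀ i, ¬ p ∣ i → (p : R) ∣ φ.coeff i) (i : ℕ) : (p : R) ∣ (derivative φ).coeff i := by
  rw [coeff_derivative]
  by_cases h : p ∣ i + 1
  · obtain ⟨k, hk⟩ := h
    refine Dvd.dvd.mul_left ?_ _
    exact ⟨k, by exact_mod_cast congrArg (Nat.cast : ℕ → R) hk⟩
  · exact Dvd.dvd.mul_right (hφ (i + 1) h) _

/-- **Frobenius shape ⇒ `p ∣ D²φ` coefficientwise, for odd `p`.** If every coefficient of `φ` in a degree
not divisible by `p` is divisible by `p`, and `p` is odd, then every coefficient of the second Hasse derivative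
`D²φ` (`(D²φ)_i = C(i+2, 2)·φ_{i+2}`) is divisible by `p`. -/
theorem dvd_coeff_hasseDeriv_two_of_frobenius_shape (p : ℕ) (hp : Odd p) (φ : R[X])
    (hφ : ∀ i, ¬ p ∣ i → (p : R) ∣ φ.coeff i) (i : ℕ) : (p : R) ∣ (hasseDeriv 2 φ).coeff i := by
  rw [hasseDeriv_coeff]
  by_cases h : p ∣ i + 2
  · obtain ⟨k, hk⟩ := dvd_choose_two_of_dvd hp h
    refine Dvd.dvd.mul_right ?_ _
    exact ⟨k, by exact_mod_cast congrArg (Nat.cast : ℕ → R) hk⟩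
  · exact Dvd.dvd.mul_left (hφ (i + 2) h) _

/-- **Taylor lemma [M] of THEORY-NOTE supplement 14.1 — polynomial core, with the note's hypotheses.**
Let `p` be ODD and `φ ∈ R[X]` with `φ ≡ A(X^p) (mod p)` (every coefficient in a degree not divisible by `p`
is divisible by `p` — for the cell: `φ = φ_p`, `φ̃_p ∈ 𝔽_p[x^p]`). Let `x' = x + p·a + p²·b`
(geometric input, untyped: `a = τ(B)·ψ₂(S)`), `φ'(x) = p·φ₁x`, `u = φ(x)` with `u^{p−1} ≡ 1 + p²F (mod p³)`
(`FQ(u) = 0`, `F = FQ₂(u)`), and `u·δ ≡ a·φ₁x (mod p)` (`δ = σ·τ(B)`, `σ = (φ_p'/p)(x_S)ψ₂(S̃)/φ_p(x_S)`). Then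
`φ(x')^{p−1} ≡ 1 + p²(F − δ) (mod p³)`, i.e. `FQ₂(φ(x')) ≡ FQ₂(u) − σ·τ(B) (mod p)`. -/
theorem fermatQuotient₂_taylor_of_frobenius_shape (p : ℕ) (hp : Odd p) (φ : R[X])
    (hφ : ∀ i, ¬ p ∣ i → (p : R) ∣ φ.coeff i) (x a b φ₁x F δ : R)
    (hφ₁ : (derivative φ).eval x = p * φ₁x)
    (hu : (p : R) ^ 3 ∣ (φ.eval x) ^ (p - 1) - (1 + (p : R) ^ 2 * F))
    (hδ : (p : R) ∣ φ.eval x * δ - a * φ₁x) :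
    (p : R) ^ 3 ∣ (φ.eval (x + (p * a + (p : R) ^ 2 * b))) ^ (p - 1) - (1 + (p : R) ^ 2 * (F - δ)) :=
  fermatQuotient₂_taylor p hp.pos φ (dvd_coeff_derivative_of_frobenius_shape p φ hφ)
    (dvd_coeff_hasseDeriv_two_of_frobenius_shape p hp φ hφ) x a b φ₁x F δ hφ₁ hu hδ

end Summit.BirchSwinnertonDyer.BirchSwinnertonDyer.Rank2Sha.Structure.TaylorFQ
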